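import Summits.KontsevichZagierPeriods.KontsevichZagierPeriods.Theorems.SoloBlindQuarticTwist
import HarnessLib

/-!
# The third first-kind quartic splitting `β(4y, ¼-3y) = β(¾-y, 4y) + 2^{6y-½}·β(¼-3y, ¾+y)`

Sol Binde (solo-blind track), 2026-08-20.

On the quartic correspondence of `SoloBlindQuarticPrep` (`D = m(m²-m+1)`, `A = 1-D`,
`Φ = D³/A⁴`; branches `φ_A = A`, `φ_B = m³/(m²-m+1)`, `ψ = 4D/(1+m²)²` on `(0,1)`) the three
Beta integrands below pull back to functions sharing the semialgebraic factor `D^{-3/4}`: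
`β(4y, ¼-3y)∘φ_A ↦ G_A = Φ^{-y}D^{-3/4}(3m²-2m+1)/A`, `β(¾-y, 4y)∘φ_B ↦ G_B =
Φ^{-y}D^{-3/4}m²(m²-2m+3)/A` (key `φ_B^{-1/4} = (m²-m+1)D^{-3/4}`), `β(¼-3y, ¾+y)∘ψ ↦ G_C =
√2·64^{-y}·Φ^{-y}D^{-3/4}(1+m)(1-m)²/(1+m²)` (key `ψ^{-3/4}(1-ψ)^{-1/4} = (√2/4)D^{-3/4}(1+m²)²/(1-m)`),
and the pointwise identity `(3m²-2m+1) - m²(m²-2m+3) = (1-m)³(1+m)` gives, inside the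
Kontsevich–Zagier rules (three substitutions and one additivity, no Stokes step),

  `β(4y, ¼-3y) = β(¾-y, 4y) + (√2·64^{-y})⁻¹ • β(¼-3y, ¾+y)`,  `0 < y < 1/12`,

hence the orbit merge `β(4y, ¼-3y) ≐ β(¼-3y, ¾+y)` (`{4y, ¼-3y, ¾-y}` meets `{¼-3y, ¾+y, 2y}`).
With `betaQ_quartic` and `betaQ_quarticTwist` this exhausts the first-kind splittings of the
Aoki–Shioda quartic family; instances at levels `16`, `24`, `28`.
-/

open MeasureTheory Set Real MvPolynomial
open Literature.NumberTheory.Transcendental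
open Literature.NumberTheory.Transcendental.KZ
open Literature.NumberTheory.Transcendental.KZ.IntegralRep

noncomputable section

namespace Summit.KontsevichZagierPeriods.KontsevichZagierPeriods.Theorems

namespace SoloBlind

/-! ## The constant `κ_y = √2·64^{-y}` and the pulled-back integrands -/

/-- `κ_y = √2·64^{-y}`, the algebraic constant produced by the pull-back along `ψ`. -/
def qrK (y : ℚ) : ℝ := Real.sqrt 2 * (64:ℝ) ^ (-(y : ℝ))

/-- `0 < κ_y`. -/
theorem qrK_pos (y : ℚ) : 0 < qrK y :=
  mul_pos (Real.sqrt_pos.mpr two_pos) (Real.rpow_pos_of_pos (by norm_num) _)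

/-- `κ_y` is algebraic. -/
theorem isAlgebraic_qrK (y : ℚ) : IsAlgebraic ℚ (qrK y) := by
  have h2 := Literature.NumberTheory.Transcendental.isAlgebraic_rpow_ratCast (α := (2:ℝ))
    (by simpa using isAlgebraic_rat ℚ (A := ℝ) 2) (by norm_num) (1 / 2)
  have h64 := qu_isAlgebraic_rpow (-y)
  push_cast at h2 h64
  unfold qrK
  rw [Real.sqrt_eq_rpow]
  exact IsAlgebraic.mul h2 h64

/-- `κ_y⁻¹ = 2^{6y-1/2}` as an element of `K₀`. -/
def qrCK (y : ℚ) : K₀ := ⟨(qrK y)⁻¹, inv_mem (mem_K₀_iff.mpr (isAlgebraic_qrK y))⟩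

/-- Coercion of `qrCK`. -/
@[simp] theorem coe_qrCK (y : ℚ) : ((qrCK y : K₀) : ℝ) = (qrK y)⁻¹ := rfl

/-- `κ_y⁻¹` is algebraic. -/
theorem isAlgebraic_qrK_inv (y : ℚ) : IsAlgebraic ℚ (qrK y)⁻¹ := mem_K₀_iff.mp (qrCK y).2

/-- `κ_y⁻¹ ≠ 0` in `K₀`. -/
theorem qrCK_ne_zero (y : ℚ) : qrCK y ≠ 0 := by
  intro h
  have h' := congrArg (fun z : K₀ => (z : ℝ)) h
  simp only [coe_qrCK, ZeroMemClass.coe_zero] at h'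
  exact (inv_pos.mpr (qrK_pos y)).ne' h'

/-- `G_A(y,m) = Φ^{-y} D^{-3/4} (3m²-2m+1)/A`. -/
def qrGA (y : ℚ) (m : ℝ) : ℝ :=
  quPhi m ^ (-(y : ℝ)) * quD m ^ (-(3 / 4 : ℝ)) * (3 * m ^ 2 - 2 * m + 1) / quA m

/-- `G_B(y,m) = Φ^{-y} D^{-3/4} m²(m²-2m+3)/A`. -/
def qrGB (y : ℚ) (m : ℝ) : ℝ :=
  quPhi m ^ (-(y : ℝ)) * quD m ^ (-(3 / 4 : ℝ)) * (m ^ 2 * (m ^ 2 - 2 * m + 3)) / quA m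

/-- `G_C(y,m) = κ_y·Φ^{-y} D^{-3/4} (1+m)(1-m)²/(1+m²)`. -/
def qrGC (y : ℚ) (m : ℝ) : ℝ :=
  qrK y * (quPhi m ^ (-(y : ℝ)) * quD m ^ (-(3 / 4 : ℝ)) * ((1 + m) * (1 - m) ^ 2) / (1 + m ^ 2))

/-! ## Keys: the quarter powers -/

/-- `φ_B^{-1/4} = (m²-m+1)·D^{-3/4}` on `(0,1)`. -/
theorem qr_quarterB {m : ℝ} (hm : m ∈ Ioo (0:ℝ) 1) :
    quB m ^ (-(1 / 4 : ℝ)) = (m ^ 2 - m + 1) * quD m ^ (-(3 / 4 : ℝ)) := by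
  have hB := (quB_mem hm).1
  have hD := quD_pos hm
  have he := ReflectionThird.sq_sub_add_one_pos m
  have he' := he.ne'
  have h0 := hm.1.ne'
  rw [← pow_left_inj₀ (Real.rpow_nonneg hB.le _) (mul_nonneg he.le (Real.rpow_nonneg hD.le _))
      (by norm_num : (4:ℕ) ≠ 0),
    mul_pow, ← Real.rpow_mul_natCast hB.le, ← Real.rpow_mul_natCast hD.le,
    show (-(1 / 4 : ℝ)) * ((4:ℕ) : ℝ) = ((-1:ℤ) : ℝ) by norm_num,
    show (-(3 / 4 : ℝ)) * ((4:ℕ) : ℝ) = ((-3:ℤ) : ℝ) by norm_num,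
    Real.rpow_intCast, Real.rpow_intCast]
  simp only [zpow_neg, zpow_ofNat]
  unfold quB quD
  field_simp

/-- `ψ^{-3/4}(1-ψ)^{-1/4} = (√2/4)·D^{-3/4}(1+m²)²/(1-m)` on `(0,1)`. -/
theorem qr_quarterC {m : ℝ} (hm : m ∈ Ioo (0:ℝ) 1) :
    quS m ^ (-(3 / 4 : ℝ)) * (1 - quS m) ^ (-(1 / 4 : ℝ)) =
      Real.sqrt 2 / 4 * quD m ^ (-(3 / 4 : ℝ)) * ((1 + m ^ 2) ^ 2 / (1 - m)) := by
  have hS := (quS_mem hm).1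
  have h1S := one_sub_quS_pos hm
  have hD := quD_pos hm
  have h1 : (0:ℝ) < 1 - m := by linarith [hm.2]
  have h1' := h1.ne'
  have h0 := hm.1.ne'
  have he := (ReflectionThird.sq_sub_add_one_pos m).ne'
  have h2 : Real.sqrt 2 ^ 4 = 4 := by
    rw [show (4:ℕ) = 2 * 2 from rfl, pow_mul, Real.sq_sqrt (by norm_num : (0:ℝ) ≤ 2)]
    norm_num
  rw [← pow_left_inj₀ (mul_nonneg (Real.rpow_nonneg hS.le _) (Real.rpow_nonneg h1S.le _))
      (mul_nonneg (mul_nonneg (by positivity) (Real.rpow_nonneg hD.le _))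
        (div_nonneg (by positivity) h1.le)) (by norm_num : (4:ℕ) ≠ 0)]
  simp only [mul_pow, div_pow, h2]
  rw [← Real.rpow_mul_natCast hS.le, ← Real.rpow_mul_natCast h1S.le,
    ← Real.rpow_mul_natCast hD.le,
    show (-(3 / 4 : ℝ)) * ((4:ℕ) : ℝ) = ((-3:ℤ) : ℝ) by norm_num,
    show (-(1 / 4 : ℝ)) * ((4:ℕ) : ℝ) = ((-1:ℤ) : ℝ) by norm_num,
    Real.rpow_intCast, Real.rpow_intCast, Real.rpow_intCast, one_sub_quS]
  simp only [zpow_neg, zpow_ofNat]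
  unfold quS quD
  field_simp

/-! ## The pull-back identities -/

/-- **Pull-back along `φ_A`:** `G_A = σ^{4y-1}(1-σ)^{-3y-3/4}|φ_A'|`, `σ = φ_A(m)`. -/
theorem qr_pullA (y : ℚ) {m : ℝ} (hm : m ∈ Ioo (0:ℝ) 1) :
    qrGA y m = betaFun (4 * y) (1 / 4 - 3 * y) (quA m) * |quA' m| := by
  have hA := quA_pos hm
  have hD := quD_pos hm
  have hΦ := quPhi_pos hm
  rw [betaFun, show (((4 * y : ℚ)) : ℝ) - 1 = ((4:ℤ) : ℝ) * (y : ℝ) + (-1) by push_cast; ring,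
    show (((1 / 4 - 3 * y : ℚ)) : ℝ) - 1 = ((-3:ℤ) : ℝ) * (y : ℝ) + (-(3 / 4 : ℝ)) by
      push_cast; ring,
    one_sub_quA, qu_master hA hD, qt_keyA hm, Real.inv_rpow hΦ.le, ← Real.rpow_neg hΦ.le,
    Real.rpow_neg_one, abs_quA']
  unfold qrGA
  rw [div_eq_mul_inv]
  ring

/-- **Pull-back along `φ_B`:** `G_B = σ^{-y-1/4}(1-σ)^{4y-1}|φ_B'|`, `σ = φ_B(m)`. -/
theorem qr_pullB (y : ℚ) {m : ℝ} (hm : m ∈ Ioo (0:ℝ) 1) :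
    qrGB y m = betaFun (3 / 4 - y) (4 * y) (quB m) * |quB' m| := by
  have hB := quB_mem hm
  have h1B : 0 < 1 - quB m := by linarith [hB.2]
  have hΦ := quPhi_pos hm
  have hA := (quA_pos hm).ne'
  have he := (ReflectionThird.sq_sub_add_one_pos m).ne'
  have h0 := hm.1.ne'
  rw [betaFun, show (((3 / 4 - y : ℚ)) : ℝ) - 1 = ((-1:ℤ) : ℝ) * (y : ℝ) + (-(1 / 4 : ℝ)) by
      push_cast; ring,
    show (((4 * y : ℚ)) : ℝ) - 1 = ((4:ℤ) : ℝ) * (y : ℝ) + (-1) by push_cast; ring,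
    qu_master hB.1 h1B, qt_keyB hm, Real.inv_rpow hΦ.le, ← Real.rpow_neg hΦ.le,
    Real.rpow_neg_one, qr_quarterB hm, one_sub_quB, abs_of_pos (quB'_pos hm)]
  have he2 : m * (m - 1) + 1 ≠ 0 := by
    have : 0 < m * (m - 1) + 1 := by nlinarith [sq_nonneg (m - 1 / 2)]
    exact this.ne'
  unfold qrGB quB'
  field_simp

/-- **Pull-back along `ψ`:** `G_C = s^{-3y-3/4}(1-s)^{y-1/4}|ψ'|`, `s = ψ(m)`. -/
theorem qr_pullC (y : ℚ) {m : ℝ} (hm : m ∈ Ioo (0:ℝ) 1) :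
    qrGC y m = betaFun (1 / 4 - 3 * y) (3 / 4 + y) (quS m) * |quS' m| := by
  have hS := quS_mem hm
  have h1S := one_sub_quS_pos hm
  have hΦ := quPhi_pos hm
  have h1 : (1:ℝ) - m ≠ 0 := by
    have : (0:ℝ) < 1 - m := by linarith [hm.2]
    exact this.ne'
  have hP : (1:ℝ) + m ^ 2 ≠ 0 := by positivity
  rw [betaFun, show (((1 / 4 - 3 * y : ℚ)) : ℝ) - 1 = ((-3:ℤ) : ℝ) * (y : ℝ) + (-(3 / 4 : ℝ)) by
      push_cast; ring,
    show (((3 / 4 + y : ℚ)) : ℝ) - 1 = ((1:ℤ) : ℝ) * (y : ℝ) + (-(1 / 4 : ℝ)) by push_cast; ring,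
    qu_master hS.1 h1S, qt_keyC hm, Real.inv_rpow (by positivity),
    Real.mul_rpow (by norm_num) hΦ.le, mul_inv, ← Real.rpow_neg hΦ.le,
    ← Real.rpow_neg (by norm_num : (0:ℝ) ≤ 64), qr_quarterC hm, abs_of_pos (quS'_pos hm)]
  unfold qrGC qrK quS'
  field_simp

/-- **Integrand additivity:** `G_A = G_B + κ_y⁻¹·G_C` on `(0,1)`, i.e.
`(3m²-2m+1) - m²(m²-2m+3) = (1-m)³(1+m)`. -/
theorem qr_add (y : ℚ) {m : ℝ} (hm : m ∈ Ioo (0:ℝ) 1) :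
    qrGA y m = qrGB y m + (qrK y)⁻¹ * qrGC y m := by
  have hA := (quA_pos hm).ne'
  have hK := (qrK_pos y).ne'
  have hP : (1:ℝ) + m ^ 2 ≠ 0 := by positivity
  have h1 : (1:ℝ) - m ≠ 0 := by
    have : (0:ℝ) < 1 - m := by linarith [hm.2]
    exact this.ne'
  unfold qrGA qrGB qrGC
  rw [show quA m = (1 - m) * (1 + m ^ 2) from rfl] at hA ⊢
  field_simp
  ring

/-! ## Integrability (by the change of variables itself) -/

/-- `G_A` is integrable on `(0,1)` for `0 < y < 1/12`. -/
theorem integrableOn_qrGA (y : ℚ) (hy : 0 < y) (hy12 : 12 * y < 1) :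
    IntegrableOn (qrGA y) (Ioo 0 1) := by
  have h := integrableOn_betaFun (4 * y) (1 / 4 - 3 * y) (by positivity) (by linarith)
  rw [image_quA, integrableOn_image_iff_integrableOn_abs_deriv_smul measurableSet_Ioo
    (fun m _ => (hasDerivAt_quA m).hasDerivWithinAt) injOn_quA] at h
  exact h.congr_fun (fun m hm => by simp only [smul_eq_mul]; rw [mul_comm, ← qr_pullA y hm])
    measurableSet_Ioo

/-- `G_B` is integrable on `(0,1)` for `0 < y < 1/12`. -/
theorem integrableOn_qrGB (y : ℚ) (hy : 0 < y) (hy12 : 12 * y < 1) :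
    IntegrableOn (qrGB y) (Ioo 0 1) := by
  have h := integrableOn_betaFun (3 / 4 - y) (4 * y) (by linarith) (by positivity)
  rw [image_quB, integrableOn_image_iff_integrableOn_abs_deriv_smul measurableSet_Ioo
    (fun m _ => (hasDerivAt_quB m).hasDerivWithinAt) injOn_quB] at h
  exact h.congr_fun (fun m hm => by simp only [smul_eq_mul]; rw [mul_comm, ← qr_pullB y hm])
    measurableSet_Ioo

/-- `G_C` is integrable on `(0,1)` for `0 < y < 1/12`. -/
theorem integrableOn_qrGC (y : ℚ) (hy : 0 < y) (hy12 : 12 * y < 1) :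
    IntegrableOn (qrGC y) (Ioo 0 1) := by
  have h := integrableOn_betaFun (1 / 4 - 3 * y) (3 / 4 + y) (by linarith) (by positivity)
  rw [image_quS, integrableOn_image_iff_integrableOn_abs_deriv_smul measurableSet_Ioo
    (fun m _ => (hasDerivAt_quS m).hasDerivWithinAt) injOn_quS] at h
  exact h.congr_fun (fun m hm => by simp only [smul_eq_mul]; rw [mul_comm, ← qr_pullC y hm])
    measurableSet_Ioo

/-! ## Semialgebraicity -/

/-- `D^{e}` is `ℚ`-semialgebraic on `(0,1)` for rational `e`. -/
theorem sa_quD_rpow (e : ℚ) :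
    IsSemialgebraicFunOn ℚ (line (Ioo (0:ℝ) 1)) (fun v : Fin 1 → ℝ => quD (v 0) ^ (e : ℝ)) := by
  have hD : IsSemialgebraicFunOn ℚ (line (Ioo (0:ℝ) 1)) (fun v : Fin 1 → ℝ => quD (v 0)) :=
    (isSemialgebraicFunOn_aeval mix_line_sa
      (X 0 * (X 0 ^ 2 - X 0 + 1) : MvPolynomial (Fin 1) ℚ)).congr fun v _ => by simp [quD]
  exact IsSemialgebraicFunOn.rpow_ratCast mix_line_sa hD
    (fun v hv => quD_pos (show v 0 ∈ Ioo (0:ℝ) 1 from hv)) e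

/-- `Φ^{-y} · D^{-3/4} · p(m) / r(m)` is `ℚ`-semialgebraic on `(0,1)` for polynomials `p`, `r`
with `r ≠ 0` there. -/
theorem sa_qr_shape (y : ℚ) (p r : MvPolynomial (Fin 1) ℚ)
    (hr : ∀ v ∈ line (Ioo (0:ℝ) 1), aeval v r ≠ 0) :
    IsSemialgebraicFunOn ℚ (line (Ioo (0:ℝ) 1))
      (fun v : Fin 1 → ℝ =>
        quPhi (v 0) ^ (-(y : ℝ)) * quD (v 0) ^ (-(3 / 4 : ℝ)) * aeval v p / aeval v r) := by
  have hΦ : IsSemialgebraicFunOn ℚ (line (Ioo (0:ℝ) 1))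
      (fun v : Fin 1 → ℝ => quPhi (v 0) ^ (-(y : ℝ))) :=
    (sa_quPhi_rpow (-y)).congr fun v _ => by push_cast; rfl
  have hD : IsSemialgebraicFunOn ℚ (line (Ioo (0:ℝ) 1))
      (fun v : Fin 1 → ℝ => quD (v 0) ^ (-(3 / 4 : ℝ))) :=
    (sa_quD_rpow (-(3 / 4))).congr fun v _ => by push_cast; rfl
  exact IsSemialgebraicFunOn.div
    (IsSemialgebraicFunOn.mul_holds (IsSemialgebraicFunOn.mul_holds hΦ hD)
      (isSemialgebraicFunOn_aeval mix_line_sa p))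
    (isSemialgebraicFunOn_aeval mix_line_sa r) hr

/-- `G_A` is `ℚ`-semialgebraic on `(0,1)`. -/
theorem sa_qrGA (y : ℚ) :
    IsSemialgebraicFunOn ℚ (line (Ioo (0:ℝ) 1)) (fun v : Fin 1 → ℝ => qrGA y (v 0)) :=
  (sa_qr_shape y (3 * X 0 ^ 2 - 2 * X 0 + 1) ((1 - X 0) * (1 + X 0 ^ 2)) qt_aeval_A_ne_zero).congr
    fun v _ => by simp [qrGA, quA]

/-- `G_B` is `ℚ`-semialgebraic on `(0,1)`. -/
theorem sa_qrGB (y : ℚ) :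
    IsSemialgebraicFunOn ℚ (line (Ioo (0:ℝ) 1)) (fun v : Fin 1 → ℝ => qrGB y (v 0)) :=
  (sa_qr_shape y (X 0 ^ 2 * (X 0 ^ 2 - 2 * X 0 + 3)) ((1 - X 0) * (1 + X 0 ^ 2))
    qt_aeval_A_ne_zero).congr fun v _ => by simp [qrGB, quA]

/-- `G_C` is `ℚ`-semialgebraic on `(0,1)`. -/
theorem sa_qrGC (y : ℚ) :
    IsSemialgebraicFunOn ℚ (line (Ioo (0:ℝ) 1)) (fun v : Fin 1 → ℝ => qrGC y (v 0)) :=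
  (IsSemialgebraicFunOn.mul_holds
    (isSemialgebraicFunOn_const_of_isAlgebraic mix_line_sa (isAlgebraic_qrK y))
    (sa_qr_shape y ((1 + X 0) * (1 - X 0) ^ 2) (1 + X 0 ^ 2) fun v _ => by
      have h : (0:ℝ) < 1 + v 0 ^ 2 := by positivity
      simpa using h.ne')).congr fun v _ => by simp [qrGC]

/-! ## The representations and the moves -/

/-- `R_A = [(0,1), G_A]`. -/
def qrRA (y : ℚ) (hy : 0 < y) (hy12 : 12 * y < 1) : IntegralRep 1 :=
  lineRep (Ioo 0 1) (qrGA y) mix_line_sa (sa_qrGA y) (integrableOn_qrGA y hy hy12)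

/-- `R_B = [(0,1), G_B]`. -/
def qrRB (y : ℚ) (hy : 0 < y) (hy12 : 12 * y < 1) : IntegralRep 1 :=
  lineRep (Ioo 0 1) (qrGB y) mix_line_sa (sa_qrGB y) (integrableOn_qrGB y hy hy12)

/-- `R_C = [(0,1), G_C]`. -/
def qrRC (y : ℚ) (hy : 0 < y) (hy12 : 12 * y < 1) : IntegralRep 1 :=
  lineRep (Ioo 0 1) (qrGC y) mix_line_sa (sa_qrGC y) (integrableOn_qrGC y hy hy12)

/-- **Move A:** `R_A ≡ β(4y, ¼-3y)`. -/
theorem qrRA_sub_betaRep (y : ℚ) (hy : 0 < y) (hy12 : 12 * y < 1) :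
    of (qrRA y hy hy12) - of (betaRep (4 * y) (1 / 4 - 3 * y) (by positivity) (by linarith)) ∈
      relations := by
  unfold qrRA betaRep
  exact lineRep_subst quA quA' sa_quA (fun m _ => (hasDerivAt_quA m).hasDerivWithinAt) injOn_quA
    image_quA (fun m hm => qr_pullA y hm)

/-- **Move B:** `R_B ≡ β(¾-y, 4y)`. -/
theorem qrRB_sub_betaRep (y : ℚ) (hy : 0 < y) (hy12 : 12 * y < 1) :
    of (qrRB y hy hy12) - of (betaRep (3 / 4 - y) (4 * y) (by linarith) (by positivity)) ∈
      relations := by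
  unfold qrRB betaRep
  exact lineRep_subst quB quB' sa_quB (fun m _ => (hasDerivAt_quB m).hasDerivWithinAt) injOn_quB
    image_quB (fun m hm => qr_pullB y hm)

/-- **Move C:** `R_C ≡ β(¼-3y, ¾+y)`. -/
theorem qrRC_sub_betaRep (y : ℚ) (hy : 0 < y) (hy12 : 12 * y < 1) :
    of (qrRC y hy hy12) - of (betaRep (1 / 4 - 3 * y) (3 / 4 + y) (by linarith) (by positivity)) ∈
      relations := by
  unfold qrRC betaRep
  exact lineRep_subst quS quS' sa_quS (fun m _ => (hasDerivAt_quS m).hasDerivWithinAt) injOn_quS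
    image_quS (fun m hm => qr_pullC y hm)

/-- **Move D (integrand additivity):** `R_A ≡ R_B + κ_y⁻¹·R_C`. -/
theorem qrRA_sub_sub (y : ℚ) (hy : 0 < y) (hy12 : 12 * y < 1) :
    of (qrRA y hy hy12) - of (qrRB y hy hy12) -
      of ((qrRC y hy hy12).constMul (qrK y)⁻¹ (isAlgebraic_qrK_inv y)) ∈ relations :=
  of_sub_sub_mem_relations_of_add rfl rfl fun v hv => by
    simp only [qrRA, qrRB, qrRC, lineRep_integrand, IntegralRep.integrand_constMul]
    exact qr_add y (show v 0 ∈ Ioo (0:ℝ) 1 from hv)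

/-! ## In `Q` -/

/-- **The third quartic splitting inside the Kontsevich–Zagier rules:**
`β(4y, ¼-3y) = β(¾-y, 4y) + 2^{6y-1/2} • β(¼-3y, ¾+y)` for rational `0 < y < 1/12`. -/
theorem betaQ_quarticR (y : ℚ) (hy : 0 < y) (hy12 : 12 * y < 1) :
    betaQ (4 * y) (1 / 4 - 3 * y) =
      betaQ (3 / 4 - y) (4 * y) + qrCK y • betaQ (1 / 4 - 3 * y) (3 / 4 + y) := by
  have hA : betaQ (4 * y) (1 / 4 - 3 * y) = mkQ (of (qrRA y hy hy12)) := by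
    rw [betaQ_eq (by positivity) (by linarith)]
    exact (mkQ_eq_mkQ_iff.mpr (qrRA_sub_betaRep y hy hy12)).symm
  have hB : mkQ (of (qrRB y hy hy12)) = betaQ (3 / 4 - y) (4 * y) := by
    rw [betaQ_eq (by linarith) (by positivity)]
    exact mkQ_eq_mkQ_iff.mpr (qrRB_sub_betaRep y hy hy12)
  have hC : mkQ (of (qrRC y hy hy12)) = betaQ (1 / 4 - 3 * y) (3 / 4 + y) := by
    rw [betaQ_eq (by linarith) (by positivity)]
    exact mkQ_eq_mkQ_iff.mpr (qrRC_sub_betaRep y hy hy12)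
  have h2 : mkQ (of (qrRA y hy hy12)) = mkQ (of (qrRB y hy hy12)) +
      mkQ (of ((qrRC y hy hy12).constMul (qrK y)⁻¹ (isAlgebraic_qrK_inv y))) := by
    rw [← map_add, mkQ_eq_mkQ_iff]
    have h := qrRA_sub_sub y hy hy12
    rwa [sub_sub] at h
  rw [hA, h2, mkQ_constMul, hB, hC]
  rfl

/-! ## The orbit merge -/

/-- **Third quartic merge: `β(4y, ¼-3y) ≐ β(¼-3y, ¾+y)`** — the orbit of `{4y, ¼-3y, ¾-y}`
meets the orbit of `{¼-3y, ¾+y, 2y}`, for every rational `0 < y < 1/12`.  Precisely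
`(sin π(¾-y) - sin π(¼-3y)) • β(4y, ¼-3y) = κ_y⁻¹ sin π(¾-y) • β(¼-3y, ¾+y)`. -/
theorem betaQ_propTo_quarticR (y : ℚ) (hy : 0 < y) (hy12 : 12 * y < 1) :
    PropTo (betaQ (4 * y) (1 / 4 - 3 * y)) (betaQ (1 / 4 - 3 * y) (3 / 4 + y)) := by
  have key := betaQ_quarticR y hy hy12
  have hp := orbit_pair (4 * y) (1 / 4 - 3 * y) (3 / 4 - y) (by positivity) (by linarith)
    (by linarith) (by ring)
  rw [betaQ_symm (show (0:ℚ) < 3 / 4 - y by linarith) (show (0:ℚ) < 4 * y by positivity)] at key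
  have key' : sinQ (3 / 4 - y) • betaQ (4 * y) (1 / 4 - 3 * y) =
      sinQ (3 / 4 - y) • betaQ (4 * y) (3 / 4 - y) +
      (sinQ (3 / 4 - y) * qrCK y) • betaQ (1 / 4 - 3 * y) (3 / 4 + y) := by
    rw [key, smul_add, smul_smul]
  rw [hp] at key'
  refine PropTo.of_smul_eq_smul (c := sinQ (3 / 4 - y) - sinQ (1 / 4 - 3 * y))
    (c' := sinQ (3 / 4 - y) * qrCK y)
    (sinQ_sub_sinQ_ne_zero_of_lt (by linarith) (by linarith) (by linarith))
    (mul_ne_zero (sinQ_ne_zero (by linarith) (by linarith)) (qrCK_ne_zero y)) ?_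
  linear_combination (norm := module) key'

/-! ## Instances: first-kind classes not reached by the other uniform moves -/

/-- Level `16`: `β(1/4, 1/16) ≐ β(1/16, 13/16)` — `{1,4,11}` meets `{1,2,13}`. -/
theorem betaQ_propTo_sixteen_qr : PropTo (betaQ (1 / 4) (1 / 16)) (betaQ (1 / 16) (13 / 16)) := by
  have h := betaQ_propTo_quarticR (1 / 16) (by norm_num) (by norm_num)
  norm_num at h
  exact h

/-- Level `24`: `β(1/6, 1/8) ≐ β(1/8, 19/24)` — `{3,4,17}` meets `{2,3,19}`. -/
theorem betaQ_propTo_twentyfour_qr :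
    PropTo (betaQ (1 / 6) (1 / 8)) (betaQ (1 / 8) (19 / 24)) := by
  have h := betaQ_propTo_quarticR (1 / 24) (by norm_num) (by norm_num)
  norm_num at h
  exact h

/-- Level `28`: `β(2/7, 1/28) ≐ β(1/28, 23/28)` — `{1,8,19}` meets `{1,4,23}`. -/
theorem betaQ_propTo_twentyeight_qr :
    PropTo (betaQ (2 / 7) (1 / 28)) (betaQ (1 / 28) (23 / 28)) := by
  have h := betaQ_propTo_quarticR (1 / 14) (by norm_num) (by norm_num)
  norm_num at h
  exact h

end SoloBlind

end Summit.KontsevichZagierPeriods.KontsevichZagierPeriods.Theorems
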